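import Summits.HodgeConjecture.HodgeConjecture.Theorems.F0P2oD7alphaMemDockStatement   -- ★ ED. 2 (F0P2-p01 (g9)): the node of record `StubD7αMemDockPerMeasureT` (text copied BYTE-IDENTICALLY below, ONE token changed)
import Literature.NumberTheory.Rogawski1990.CMThetaDockingClausesTestW1                  -- ROAD W (a): `CMThetaDockingClausesTestW1`, `cmThetaDockingClausesTest_toW1`
import HarnessLib

/-!
# Crux `H413`, programme P2 — THE D7α NODE ON TEST FUNCTIONS, DOCKᵀ RESTRICTED TO THE WEIGHT-ONE AUTOMORPHIC LOCUS («W1»): `StubD7αMemDockPerMeasureTW1` (statement only)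

Cell `hodgecm-mathlib` (D-0151), FLOOR 0, crux item H413 = `stmt-HodgeConjecture-24833`, route of record `HCCMUnconditional`; programme P2, fallback road PKΠ
`Cruxes/H413/Lines/F0_P2PKPiRung4.lean` (node of record `stub_D7αMemDockμT : StubD7αMemDockPerMeasureT`, v1.15).  ROAD W of the LH10 line: LH10-p02 (g0) architectural ask
2026-09-02T03:19:42Z, F0P2-p06 (g14) census 03:24:26Z, F0P2-ref1 (g10) r363 (2)∕(3) + r364 (3) «cut (c) HOME-first; FILE only on LEAD + director «v1.16 W1 GO»».  Seat
F0P2-p06 (g14).  DEFINITION ONLY (one `def … : Prop` with body) + the monotonicity theorem from the node of record; no instance, no notation, no `sorry`; ★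
`F0P2oD7alphaMemDockStatement` is NOT edited (supersede-not-edit).  `--supports stmt-HodgeConjecture-24833 --as helper`.  HONEST LABEL: HC_CM is proved only modulo the
printed citations (2 remaining named inputs hLiu418 24832, h413 24833) until rung 0 closes; this file ASSERTS NOTHING — it names a statement.

THE TEXT.  `StubD7αMemDockPerMeasureTW1` is ★ `StubD7αMemDockPerMeasureT` (ED. 2, :141–:190) BY PASTE with EXACTLY ONE token changed: the DOCKᵀ conjunct
`CMThetaDockingClausesTest L H Δ …` ↦ `CMThetaDockingClausesTestW1 L H Δ …` (ROAD W (a): the same clause with `HasWeight L μ 1 →` and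
`IsAutomorphicOneChar (↥(maximalRealSubfield L)) L (IsCMField.complexConj L) χf →` inserted after the unit-norm hypothesis).  SHAPE and MEM_μ are byte-identical.  WHY:
the node's only consumer (★ `F0P2vPKPiOfTokens.pkPi_of_tokens` :208–:221 via ★ `d7alpha_packet_members_thetaClassTest` :143; skeleton :897 → :936) eliminates DOCKᵀ's `∀ μ χf`
only at the DICT-CHOICE witness `(grdMu ξ, grdChi ξ)` where `hw : HasWeight … 1` and `haut : IsAutomorphicOneChar …` are in scope, so the W1 node serves it at the cost of two
arguments — while its DOCKᵀ-W1 is fed by the (D-b)ᵀˢ-W1 letter that LH10 pays IN-HOUSE on the Liu locus (LH10-p02 ‹O1♭″›).  ADOPTION (`stub_D7αMemDockμT` re-pointed to this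
node, `StubRIGfDict` + 2 binders) is a skeleton edition v1.16 = a 27455 re-registration: LEAD + director's word.  `stubD7αMemDockPerMeasureT_toW1`: the node of record implies
the W1 node (★ `cmThetaDockingClausesTest_toW1` under the ∃).

References: [Rogawski1990] §13.1 Prop. 13.1.3 (d), Prop. 13.1.4 p. 199; §12.2 (2) pp. 173–174; Thm. 13.3.7; §14.6 p. 246.  [GelbartRogawski1991] Lem. 5.1.2 p. 466.
[Liu2021] Def. 4.11, Prop. 4.13.
-/

set_option autoImplicit false
-- the mandated namespace repeats `HodgeConjecture.HodgeConjecture`, as in every `Theorems/*.lean` of this sub-problem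
set_option linter.dupNamespace false

noncomputable section

open NumberField MeasureTheory IsDedekindDomain
open scoped Matrix ComplexOrder

namespace Summit.HodgeConjecture.HodgeConjecture.Cruxes.H413.F0P2oD7alphaMemDockStatementW1

open Literature.NumberTheory Literature.NumberTheory.Automorphic Literature.NumberTheory.Automorphic.UnitaryGroup
open Literature.NumberTheory.Automorphic.UnitaryGroup.CotangentForms
open Literature.NumberTheory.Automorphic.IdeleClassGroup
open Literature.NumberTheory.GelbartRogawski1991
open Literature.NumberTheory.GaloisRepresentations
open Literature.NumberTheory.Rogawski1990

set_option synthInstance.maxHeartbeats 400000 in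
set_option maxHeartbeats 8000000 in
/-- **MEM + SHAPE + DOCKᵀ-W1, PER MEASURE, PACKET-LEVEL** — ★ `StubD7αMemDockPerMeasureT` (ED. 2) BY PASTE with the DOCKᵀ conjunct re-pointed to `CMThetaDockingClausesTestW1`
(print's theta-docking clause [Rogawski1990 Prop. 13.1.3 (d), 13.1.4; GelbartRogawski1991 Lem. 5.1.2] RESTRICTED to the weight-one automorphic locus `(HasWeight μ 1,
IsAutomorphicOneChar χf)` — the only locus HC_CM instantiates, ★ `pkPi_of_tokens` :208–:221 ∕ skeleton :936); SHAPE and MEM_μ unchanged.  An ENGINE node (closed `Prop` of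
the line tree, no cite tag on a closed-header `def`, D246), not a print letter.
(print: Rogawski1990, §13.1 Prop. 13.1.3 (d), Prop. 13.1.4 p. 199; §12.2 (2) pp. 173–174; Thm. 13.3.7; §14.6 p. 246) (print: GelbartRogawski1991, Lem. 5.1.2 p. 466) -/
def StubD7αMemDockPerMeasureTW1 : Prop :=
  ∀ (L : Type) [Field L] [NumberField L] [IsCMField L] (ι : L →+* ℂ) (H : Matrix (Fin 3) (Fin 3) L) (T : GL (Fin 3) ℂ)
    (hT : (T : Matrix (Fin 3) (Fin 3) ℂ)ᴴ * H.map ι * (T : Matrix (Fin 3) (Fin 3) ℂ) = Literature.Geometry.ComplexHyperbolic.BallModel.J),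
    (∀ τ' : L →+* ℂ, InfinitePlace.mk τ' ≠ InfinitePlace.mk ι → (H.map τ').PosDef) → 2 ≤ Module.finrank ℚ ↥(maximalRealSubfield L) →
    ∀ (μω : HeckeCharacter L) (hμu : μω.IsUnitary),
      (∀ x : Literature.NumberTheory.GaloisRepresentations.ideleGroup ↥(maximalRealSubfield L), μω (AdeleRing.ideleBaseChange (↥(maximalRealSubfield L)) L x) = quadraticHeckeCharCM L x) →
    ∀ (μ : Measure (adelicGroupData (↥(maximalRealSubfield L)) L (IsCMField.complexConj L) 3 H).automorphicQuotient) [(adelicGroupData (↥(maximalRealSubfield L)) L (IsCMField.complexConj L) 3 H).IsAutomorphicMeasure μ],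
    letI : ∀ v : HeightOneSpectrum (𝓞 ↥(maximalRealSubfield L)), MeasurableSpace ((cmDatum L 3 H).Local v) := fun _ => borel _
    letI : ∀ v : HeightOneSpectrum (𝓞 ↥(maximalRealSubfield L)),
        MeasurableSpace ((cmDatum L 2 (Matrix.of fun i j : Fin 2 => if i.val + j.val + 1 = 2 then (1 : L) else 0)).Local v ×
          (cmDatum L 1 (Matrix.of fun i j : Fin 1 => if i.val + j.val + 1 = 1 then (1 : L) else 0)).Local v) := fun _ => borel _
    letI : ∀ (v : HeightOneSpectrum (𝓞 ↥(maximalRealSubfield L)))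
        (a : ((cmDatum L 2 (Matrix.of fun i j : Fin 2 => if i.val + j.val + 1 = 2 then (1 : L) else 0)).Local v ×
          (cmDatum L 1 (Matrix.of fun i j : Fin 1 => if i.val + j.val + 1 = 1 then (1 : L) else 0)).Local v)),
        MeasurableSpace (((cmDatum L 2 (Matrix.of fun i j : Fin 2 => if i.val + j.val + 1 = 2 then (1 : L) else 0)).Local v ×
            (cmDatum L 1 (Matrix.of fun i j : Fin 1 => if i.val + j.val + 1 = 1 then (1 : L) else 0)).Local v) ⧸
          Subgroup.centralizer ({a} : Set ((cmDatum L 2 (Matrix.of fun i j : Fin 2 => if i.val + j.val + 1 = 2 then (1 : L) else 0)).Local v ×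
            (cmDatum L 1 (Matrix.of fun i j : Fin 1 => if i.val + j.val + 1 = 1 then (1 : L) else 0)).Local v))) := fun _ _ => borel _
    letI : ∀ (v : HeightOneSpectrum (𝓞 ↥(maximalRealSubfield L))) (γ : (cmDatum L 3 H).Local v),
        MeasurableSpace ((cmDatum L 3 H).Local v ⧸ Subgroup.centralizer ({γ} : Set ((cmDatum L 3 H).Local v))) := fun _ _ => borel _
    letI : ∀ v : HeightOneSpectrum (𝓞 ↥(maximalRealSubfield L)), MeasurableSpace (Gqs L v ⧸ Subgroup.center (Gqs L v)) := fun _ => borel _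
    ∃ (Δ : ∀ v : HeightOneSpectrum (𝓞 ↥(maximalRealSubfield L)), LocalTransferFactor L H v)
      (mH : ∀ v : HeightOneSpectrum (𝓞 ↥(maximalRealSubfield L)),
    OrbitalMeasureFamily ((cmDatum L 2 (Matrix.of fun i j : Fin 2 => if i.val + j.val + 1 = 2 then (1 : L) else 0)).Local v ×
      (cmDatum L 1 (Matrix.of fun i j : Fin 1 => if i.val + j.val + 1 = 1 then (1 : L) else 0)).Local v))
      (mG : ∀ v : HeightOneSpectrum (𝓞 ↥(maximalRealSubfield L)), OrbitalMeasureFamily ((cmDatum L 3 H).Local v))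
      (νG : ∀ v : HeightOneSpectrum (𝓞 ↥(maximalRealSubfield L)), Measure ((cmDatum L 3 H).Local v))
      (νH : ∀ v : HeightOneSpectrum (𝓞 ↥(maximalRealSubfield L)),
    Measure ((cmDatum L 2 (Matrix.of fun i j : Fin 2 => if i.val + j.val + 1 = 2 then (1 : L) else 0)).Local v ×
      (cmDatum L 1 (Matrix.of fun i j : Fin 1 => if i.val + j.val + 1 = 1 then (1 : L) else 0)).Local v))
      (ξloc : OneDimAutRepH L → ∀ v : HeightOneSpectrum (𝓞 ↥(maximalRealSubfield L)),
    (cmDatum L 2 (Matrix.of fun i j : Fin 2 => if i.val + j.val + 1 = 2 then (1 : L) else 0)).Local v ×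
      (cmDatum L 1 (Matrix.of fun i j : Fin 1 => if i.val + j.val + 1 = 1 then (1 : L) else 0)).Local v →* ℂˣ)
      (μZ : ∀ v : HeightOneSpectrum (𝓞 ↥(maximalRealSubfield L)), Measure (Gqs L v ⧸ Subgroup.center (Gqs L v)))
      (packFin : OneDimAutRepH L → ∀ v : HeightOneSpectrum (𝓞 ↥(maximalRealSubfield L)), CMLocalAPacket L H v)
      (_hHaar : ∀ v : HeightOneSpectrum (𝓞 ↥(maximalRealSubfield L)), (μZ v).IsHaarMeasure)
      (_hνG : ∀ v : HeightOneSpectrum (𝓞 ↥(maximalRealSubfield L)), (νG v).IsHaarMeasure),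
      -- DOCKᵀ-W1: the theta-docking clause ON TEST FUNCTIONS RESTRICTED TO THE WEIGHT-ONE AUTOMORPHIC LOCUS (`CMThetaDockingClausesTestW1`) for every theta frame and every `ξ`
      (∀ {n' : ℕ} (e₁ : Fin 3 × Fin 1 ≃ Fin n') (dV : Fin 3 → L) (hdV : ∀ i, IsCMField.complexConj L (dV i) = dV i) (hdV0 : ∀ i, dV i ≠ 0) (g : GL (Fin 3) L)
          (hg : ((g : Matrix (Fin 3) (Fin 3) L).map (cmConjRingHom L))ᵀ * H * (g : Matrix (Fin 3) (Fin 3) L) = Matrix.diagonal dV) (ξ : OneDimAutRepH L),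
          CMThetaDockingClausesTestW1 L H Δ mH mG νH νG ξ μω (ξloc ξ) e₁ dV hdV hdV0 g hg) ∧
      -- SHAPE: at every non-split `v` the packet of `ξ` is `⟨πⁿ ∘ e, some πˢ⟩` — Keys labels `(π², πⁿ)`, `πˢ` supercuspidal, `πˢ ≠ πⁿ ∘ e`, and the identity (13.1.4)
      -- for `⟨πⁿ ∘ e, some πˢ⟩` ON TEST FUNCTIONS (the binder block of ★ `F0P2oD7alphaMembersThetaClassTest.d7alpha_packet_members_thetaClassTest`, token for token)
      (∀ (ξ : OneDimAutRepH L) (v : HeightOneSpectrum (𝓞 ↥(maximalRealSubfield L))),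
          (∀ w : PlacesOver L v, IsCMField.complexConj L • w.1 = w.1) →
          ∃ (T : GL (Fin 3) (LocalRing L v)) (a : LocalRing L v) (ha : IsUnit a)
            (h : formCongr (conjLocal L (IsCMField.complexConj L) v) T (H.map (algebraMap L (LocalRing L v))) =
              a • (Matrix.of fun i j : Fin 3 => if i.val + j.val + 1 = 3 then (1 : L) else 0).map (algebraMap L (LocalRing L v)))
            (π2 πn : IrrClass (Gqs L v)) (πs : IrrClass ((cmDatum L 3 H).Local v)),
            KeysCaseTwoLabels L v (μω.semilocalComponent L v) (torusLocalComponent L (IsCMField.complexConj L) v ξ.η)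
                (torusLocalComponent L (IsCMField.complexConj L) v ξ.ψ) π2 πn ∧
              π2.IsSquareIntegrable (μZ v) ∧ ¬ πn.IsSquareIntegrable (μZ v) ∧ πs.IsSupercuspidal ∧
              πs ≠ IrrClass.comap (cmDatumLocalCongr L v T ha h).symm πn ∧
              (⟨IrrClass.comap (cmDatumLocalCongr L v T ha h).symm πn, some πs⟩ : CMLocalAPacket L H v).CharIdentityAtTest L H v
                (fun c f => c.smoothTrace (νG v) f) (ξloc ξ v) (νH v) (Δ v) (mH v) (mG v) ∧
              packFin ξ v = ⟨IrrClass.comap (cmDatumLocalCongr L v T ha h).symm πn, some πs⟩) ∧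
      -- MEM_μ: every local constituent class of a cotangent `μ`-discrete `P`'s finite component at a non-split `v` is a member of `packFin ξ v`
      (∀ (W : Type) [AddCommGroup W] [Module ℂ W]
          (σ : Representation ℂ (finAdelic (↥(maximalRealSubfield L)) L (IsCMField.complexConj L) 3 H) W),
          σ.IsIrreducible → σ.IsSmooth → σ.IsAdmissible →
        ∀ (P : DiscreteAutomorphicRep (adelicGroupData (↥(maximalRealSubfield L)) L (IsCMField.complexConj L) 3 H) μ),
          (P.IsHolCotangentAt (cmArchSection L ι H T hT) (cmCompactFactor L ι H T hT) ∨
            P.IsAntiholCotangentAt (cmArchSection L ι H T hT) (cmCompactFactor L ι H T hT)) →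
          P.HasFinComponent σ →
        ∀ (ξ : OneDimAutRepH L),
          MemXiFamily P (transpose_map_cmConjRingHom_eq_of_frame L ι H T hT) (isUnit_det_of_frame L ι H T hT) μω hμu ξ →
        ∀ (v : HeightOneSpectrum (𝓞 ↥(maximalRealSubfield L))),
          (∀ w : PlacesOver L v, IsCMField.complexConj L • w.1 = w.1) →
          ∀ c : IrrClass ((cmDatum L 3 H).Local v),
            (IrrClass.comap (localPiEquiv L (IsCMField.complexConj L) 3 H v) c).IsConstituentOf
                (σ.comp (inclPlace (↥(maximalRealSubfield L)) L (IsCMField.complexConj L) 3 H v)) →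
            c ∈ (packFin ξ v).members)

set_option synthInstance.maxHeartbeats 400000 in
set_option maxHeartbeats 8000000 in
/-- **MONOTONICITY — the node of record implies the W1 node** (DOCKᵀ ⟹ DOCKᵀ-W1 by ★ `cmThetaDockingClausesTest_toW1`; every other conjunct passed through).
(print: Rogawski1990, §13.1 Prop. 13.1.4 p. 199) (print: GelbartRogawski1991, Lem. 5.1.2 p. 466) -/
theorem stubD7αMemDockPerMeasureT_toW1 (h : F0P2oD7alphaMemDockStatement.StubD7αMemDockPerMeasureT) : StubD7αMemDockPerMeasureTW1 := by
  intro L _ _ _ ι H T hT hdef h2 μω hμu hμω μ _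
  letI : ∀ v : HeightOneSpectrum (𝓞 ↥(maximalRealSubfield L)), MeasurableSpace ((cmDatum L 3 H).Local v) := fun _ => borel _
  letI : ∀ v : HeightOneSpectrum (𝓞 ↥(maximalRealSubfield L)),
      MeasurableSpace ((cmDatum L 2 (Matrix.of fun i j : Fin 2 => if i.val + j.val + 1 = 2 then (1 : L) else 0)).Local v ×
        (cmDatum L 1 (Matrix.of fun i j : Fin 1 => if i.val + j.val + 1 = 1 then (1 : L) else 0)).Local v) := fun _ => borel _
  letI : ∀ (v : HeightOneSpectrum (𝓞 ↥(maximalRealSubfield L)))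
      (a : ((cmDatum L 2 (Matrix.of fun i j : Fin 2 => if i.val + j.val + 1 = 2 then (1 : L) else 0)).Local v ×
        (cmDatum L 1 (Matrix.of fun i j : Fin 1 => if i.val + j.val + 1 = 1 then (1 : L) else 0)).Local v)),
      MeasurableSpace (((cmDatum L 2 (Matrix.of fun i j : Fin 2 => if i.val + j.val + 1 = 2 then (1 : L) else 0)).Local v ×
          (cmDatum L 1 (Matrix.of fun i j : Fin 1 => if i.val + j.val + 1 = 1 then (1 : L) else 0)).Local v) ⧸
        Subgroup.centralizer ({a} : Set ((cmDatum L 2 (Matrix.of fun i j : Fin 2 => if i.val + j.val + 1 = 2 then (1 : L) else 0)).Local v ×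
          (cmDatum L 1 (Matrix.of fun i j : Fin 1 => if i.val + j.val + 1 = 1 then (1 : L) else 0)).Local v))) := fun _ _ => borel _
  letI : ∀ (v : HeightOneSpectrum (𝓞 ↥(maximalRealSubfield L))) (γ : (cmDatum L 3 H).Local v),
      MeasurableSpace ((cmDatum L 3 H).Local v ⧸ Subgroup.centralizer ({γ} : Set ((cmDatum L 3 H).Local v))) := fun _ _ => borel _
  letI : ∀ v : HeightOneSpectrum (𝓞 ↥(maximalRealSubfield L)), MeasurableSpace (Gqs L v ⧸ Subgroup.center (Gqs L v)) := fun _ => borel _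
  obtain ⟨Δ, mH, mG, νG, νH, ξloc, μZ, packFin, hHaar, hνG, hDock, hShape, hMem⟩ := h L ι H T hT hdef h2 μω hμu hμω μ
  exact ⟨Δ, mH, mG, νG, νH, ξloc, μZ, packFin, hHaar, hνG,
    fun e₁ dV hdV hdV0 g hg ξ => cmThetaDockingClausesTest_toW1 L H Δ mH mG νH νG ξ μω (ξloc ξ) e₁ dV hdV hdV0 g hg (hDock e₁ dV hdV hdV0 g hg ξ), hShape, hMem⟩

end Summit.HodgeConjecture.HodgeConjecture.Cruxes.H413.F0P2oD7alphaMemDockStatementW1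

end
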